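import Summits.CriticalPhenomena.CardyFormulaZ2.Theorems.CardyBoundaryCoulombGasAssemblySandwich
import Summits.CriticalPhenomena.CardyFormulaZ2.Theorems.CardyBoundaryCoulombGasRectilinearSufficesApprox

/-!
# `Assembly` and `RectilinearSuffices` (route CardyBoundaryCoulombGas of `CardyFormulaZ2`)

Items stmt-CriticalPhenomena-13894 (`Assembly`, rank 1) and stmt-CriticalPhenomena-5663
(`RectilinearSuffices`, support): **Cardy's formula for bond-`ℤ²` at `p = 1/2` in every
rectilinear conformal rectangle implies it in every conformal rectangle**
(`cardyFormulaZ2_of_rectilinearCardy`), hence `RectilinearSuffices` and the frame statement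
`Assembly := StripClusterRates → RectilinearCardy → HalfPlaneMarkDensityLaw →
HalfPlaneOneArmThird → CardyFormulaZ2` (only `RectilinearCardy` is used).

Proof (Bollobás–Riordan's construction-free sandwich, Ch. 7 Claim 19 + remark p. 195, for the
tree's G02 discretisation of bond-`ℤ²`). Fix `R` with uniformizing datum `(φ, x)`, `L = F(η_R)`,
`e > 0`. LOWER: Radó continuity (`stub_cardyContinuity`) gives `ε₁`; the comparison geometry
(`stub_comparisonGeometry`) gives a lower quad `Q` with room `r` whose loop and marks are
`ε₁/2`-close to those of `R`; `exists_rectilinear_close` gives a RECTILINEAR `P` with the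
marks of `Q` and loop `min (ε₁/2) (r/2)`-close, so `|F(η_P) - L| ≤ e/3` and, by the lower
inclusion (`discreteCrossing_subset_of_lower`, stub A), `bond P δ ≤ bond R δ` for small `δ`;
`RectilinearCardy` gives `bond P δ → F(η_P)`. UPPER: the same for the cyclically re-marked copy
`R₂` (`stub_cyclicFlip`: `F(η_{R₂}) = 1 - L`) and the upper quad `N`:
`bond R δ ≤ 1 - P[plate path of N] ≤ 1 - bond P' δ` (`bond_le_one_sub_real_openCrossing`, stub
B + self-duality; `discreteCrossing_subset_plate`) with `bond P' δ → F(η_{P'})`,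
`|F(η_{P'}) - (1 - L)| ≤ e/3`. Hence `bond R δ → L`.

References: B. Bollobás, O. Riordan, *Percolation* (2006), Ch. 7; S. Smirnov (2001) §2;
F. Camia, C. M. Newman (2007) Thm 3 (approximation hygiene).
-/

noncomputable section

namespace Summit.CriticalPhenomena.CardyFormulaZ2.Theorems

namespace RectilinearApproximation

open Set Metric List Filter Topology MeasureTheory
open Literature.Probability.LatticeModels Literature.Probability.Percolation
open Literature.Probability.RandomPlanarGeometry
open Summit.CriticalPhenomena.CardyFormulaZ2.Cruxes.LoopsToCrossings.OracleSandwich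
  (stub_discreteCrossing_of_pathIn stub_not_discreteCrossing_of_dualPathIn stub_cardyContinuity
    stub_comparisonGeometry stub_cyclicFlip)
open Summit.CriticalPhenomena.CardyFormulaZ2.Theses.CardyBoundaryCoulombGas
  (RectilinearCardy RectilinearSuffices Assembly)

/-! ### The sandwich: `RectilinearCardy → CardyFormulaZ2` -/

/-- **Cardy's formula for rectilinear conformal rectangles implies Cardy's formula for all
conformal rectangles** (`RectilinearSuffices` of route CardyBoundaryCoulombGas, stmt-5663).
Bollobás–Riordan's construction-free sandwich (Ch. 7 Claim 19 + remark p. 195) for bond-`ℤ²`: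
a G02 crossing of a rectilinear approximant `P` of the lower comparison quad of `R` IS a G02
crossing of `R` (stub A), and a dual plate path of the upper comparison quad excludes one
(stub B, bond self-duality), the plate paths being produced by crossings of a rectilinear
approximant of the upper quad; the approximants have the marks of the quads and uniformly close
boundary loops (`exists_rectilinear_close` of `CardyBoundaryCoulombGasRectilinearSufficesApprox.lean`,
the parallel seat's rectilinear approximation; an independent construction with the `=` form of
the frontier is `RectilinearApproximation.exists_rectilinear_close_marks`), so their Cardy values are close to `F(η_R)`,
resp. `1 - F(η_R)` (Radó continuity `stub_cardyContinuity`, cyclic flip `stub_cyclicFlip`), and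
`RectilinearCardy` gives their crossing limits. [cite: BollobasRiordan2006, Ch. 7 Lemma 14 p. 184, Claims 19–20 p. 192, remark p. 195] -/
theorem cardyFormulaZ2_of_rectilinearCardy (hRC : RectilinearCardy) : _root_.CardyFormulaZ2 := by
  intro R φ x hux
  set L : ℝ := Literature.Probability.RandomPlanarGeometry.cardyFunction (crossRatio x) with hL
  -- the cyclically re-marked copy and the two continuity moduli
  obtain ⟨R₂, _hcar, hbd, hmk, hflip⟩ := stub_cyclicFlip R
  obtain ⟨φ₂, x₂, hux₂⟩ := MarkedDomain.exists_isUniformizing_holds R₂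
  -- lower bound
  have hlow : ∀ e : ℝ, 0 < e → ∀ᶠ δ : ℝ in 𝓝[>] 0, L - e < bondDomainCrossingProb R δ := by
    intro e he
    obtain ⟨ε₁, hε₁, h1⟩ := stub_cardyContinuity R φ x hux (e / 3) (by positivity)
    obtain ⟨m, hm, hgeo⟩ := stub_comparisonGeometry R (ε₁ / 2) (by positivity)
    obtain ⟨δ₀, hδ₀, t₀, ht₀, hAfor⟩ := stub_discreteCrossing_of_pathIn R
    obtain ⟨⟨Q, r, hr, hQb, hQm, hL1, hL2, hL3, hL4⟩, -⟩ := hgeo t₀ ht₀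
    obtain ⟨P, hPmark, hPS, hPclose⟩ :=
      Summit.CriticalPhenomena.CardyFormulaZ2.Theorems.exists_rectilinear_close Q
        (ε := min (ε₁ / 2) (r / 2)) (lt_min (by positivity) (by positivity))
    obtain ⟨ψ, y, hψ⟩ := MarkedDomain.exists_isUniformizing_holds P
    have hF : |Literature.Probability.RandomPlanarGeometry.cardyFunction (crossRatio y) - L| ≤ e / 3 := by
      refine h1 P (fun u => ?_) (fun i => ?_) ψ y hψ
      · calc dist (P.boundary u) (R.boundary u)
            ≤ dist (P.boundary u) (Q.boundary u) + dist (Q.boundary u) (R.boundary u) := dist_triangle _ _ _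
          _ ≤ min (ε₁ / 2) (r / 2) + ε₁ / 2 := add_le_add (hPclose u) (hQb u)
          _ ≤ ε₁ := by have := min_le_left (ε₁ / 2) (r / 2); linarith
      · rw [hPmark i]; exact (hQm i).trans (by linarith)
    have hPlim : Tendsto (bondDomainCrossingProb P) (𝓝[>] 0)
        (𝓝 (Literature.Probability.RandomPlanarGeometry.cardyFunction (crossRatio y))) :=
      hRC P hPS ψ y hψ
    have hev1 : ∀ᶠ δ : ℝ in 𝓝[>] 0,
        Literature.Probability.RandomPlanarGeometry.cardyFunction (crossRatio y) - e / 3 <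
          bondDomainCrossingProb P δ :=
      hPlim.eventually (lt_mem_nhds (by linarith))
    have hev2 : ∀ᶠ δ : ℝ in 𝓝[>] 0, δ ∈ Ioo 0 (min δ₀ (min m (r / 2))) :=
      Ioo_mem_nhdsGT (lt_min hδ₀ (lt_min hm (by positivity)))
    filter_upwards [hev1, hev2] with δ hδ1 hδ2
    have hδ₀' : δ < δ₀ := hδ2.2.trans_le (min_le_left _ _)
    have hδm : δ < m := hδ2.2.trans_le ((min_le_right _ _).trans (min_le_left _ _))
    have hδr : δ < r / 2 := hδ2.2.trans_le ((min_le_right _ _).trans (min_le_right _ _))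
    have hincl := discreteCrossing_subset_of_lower R Q P hAfor hL1 hL2 hL3 hL4 hPclose hPmark
      (le_min (by positivity) (by positivity)) (min_le_right _ _) hδ2.1 hδ₀' hδm hδr.le ht₀.le
    have hle : bondDomainCrossingProb P δ ≤ bondDomainCrossingProb R δ := by
      rw [bondDomainCrossingProb_eq_measureReal, bondDomainCrossingProb_eq_measureReal]
      exact measureReal_mono hincl
    have hF' := (abs_sub_le_iff.1 hF).2
    linarith
  -- upper bound
  have hup : ∀ e : ℝ, 0 < e → ∀ᶠ δ : ℝ in 𝓝[>] 0, bondDomainCrossingProb R δ < L + e := by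
    intro e he
    obtain ⟨ε₂, hε₂, h2⟩ := stub_cardyContinuity R₂ φ₂ x₂ hux₂ (e / 3) (by positivity)
    obtain ⟨m, hm, hgeo⟩ := stub_comparisonGeometry R (ε₂ / 2) (by positivity)
    obtain ⟨δ₀, hδ₀, t₀, ht₀, hBfor⟩ := stub_not_discreteCrossing_of_dualPathIn R m hm
    obtain ⟨-, ⟨N, r, hr, hNb, hNm, hU1, hU2, hU3, hU4, hU5⟩⟩ := hgeo t₀ ht₀
    obtain ⟨P, hPmark, hPS, hPclose⟩ :=
      Summit.CriticalPhenomena.CardyFormulaZ2.Theorems.exists_rectilinear_close N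
        (ε := min (ε₂ / 2) (r / 4)) (lt_min (by positivity) (by positivity))
    obtain ⟨ψ, y, hψ⟩ := MarkedDomain.exists_isUniformizing_holds P
    have hF : |Literature.Probability.RandomPlanarGeometry.cardyFunction (crossRatio y) - (1 - L)| ≤ e / 3 := by
      rw [← hflip φ x φ₂ x₂ hux hux₂]
      refine h2 P (fun u => ?_) (fun i => ?_) ψ y hψ
      · rw [hbd u]
        calc dist (P.boundary u) (R.boundary (u + R.mark 1))
            ≤ dist (P.boundary u) (N.boundary u) + dist (N.boundary u) (R.boundary (u + R.mark 1)) :=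
              dist_triangle _ _ _
          _ ≤ min (ε₂ / 2) (r / 4) + ε₂ / 2 := add_le_add (hPclose u) (hNb u)
          _ ≤ ε₂ := by have := min_le_left (ε₂ / 2) (r / 4); linarith
      · rw [hPmark i, hmk i]; exact (hNm i).trans (by linarith)
    have hPlim : Tendsto (bondDomainCrossingProb P) (𝓝[>] 0)
        (𝓝 (Literature.Probability.RandomPlanarGeometry.cardyFunction (crossRatio y))) :=
      hRC P hPS ψ y hψ
    have hev1 : ∀ᶠ δ : ℝ in 𝓝[>] 0,
        Literature.Probability.RandomPlanarGeometry.cardyFunction (crossRatio y) - e / 3 <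
          bondDomainCrossingProb P δ :=
      hPlim.eventually (lt_mem_nhds (by linarith))
    have hev2 : ∀ᶠ δ : ℝ in 𝓝[>] 0, δ ∈ Ioo 0 (min δ₀ (min (m / 3) (r / 4))) :=
      Ioo_mem_nhdsGT (lt_min hδ₀ (lt_min (by positivity) (by positivity)))
    filter_upwards [hev1, hev2] with δ hδ1 hδ2
    have hδ₀' : δ < δ₀ := hδ2.2.trans_le (min_le_left _ _)
    have hδm : δ < m / 3 := hδ2.2.trans_le ((min_le_right _ _).trans (min_le_left _ _))
    have hδr : δ < r / 4 := hδ2.2.trans_le ((min_le_right _ _).trans (min_le_right _ _))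
    have hle := bond_le_one_sub_real_openCrossing R hBfor hU1 hU2 hU3 hU4 hU5 hδ2.1 hδ₀'
      (by linarith) (by linarith) ht₀.le le_rfl
    have hincl := discreteCrossing_subset_plate N P hPclose hPmark
      (le_min (by positivity) (by positivity)) (min_le_right _ _) hδ2.1 hδr.le
    have hle' : bondDomainCrossingProb P δ ≤ (bondPercolation (zdGraph 2) half).real
        (openCrossing {x : Site 2 | meshPoint δ x ∈ cthickening (r / 2) N.carrier}
          {x | meshPoint δ x ∈ cthickening (r / 2) (N.arc 0)}
          {x | meshPoint δ x ∈ cthickening (r / 2) (N.arc 2)}) := by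
      rw [bondDomainCrossingProb_eq_measureReal]
      exact measureReal_mono hincl
    have hF' := (abs_sub_le_iff.1 hF).2
    linarith
  rw [Metric.tendsto_nhds]
  intro e he
  filter_upwards [hlow e he, hup e he] with δ hδ1 hδ2
  rw [Real.dist_eq, abs_sub_lt_iff]
  constructor <;> linarith

end RectilinearApproximation

/-- **`RectilinearSuffices`** (support item stmt-CriticalPhenomena-5663 of route
CardyBoundaryCoulombGas): Cardy's formula for bond-`ℤ²` at `p = 1/2` in every rectilinear
conformal rectangle implies it in every conformal rectangle. [folklore] -/
theorem RectilinearSuffices_proof :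
    Summit.CriticalPhenomena.CardyFormulaZ2.Theses.CardyBoundaryCoulombGas.RectilinearSuffices :=
  fun h => RectilinearApproximation.cardyFormulaZ2_of_rectilinearCardy h

/-- **`Assembly`** (item stmt-CriticalPhenomena-13894 of route CardyBoundaryCoulombGas): the typed
cruxes of the line imply the conjunct — in fact `RectilinearCardy` alone does, through
`RectilinearSuffices`; `StripClusterRates`, `HalfPlaneMarkDensityLaw`, `HalfPlaneOneArmThird` are
not used. [folklore] -/
theorem Assembly_proof :
    Summit.CriticalPhenomena.CardyFormulaZ2.Theses.CardyBoundaryCoulombGas.Assembly :=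
  fun _ hRect _ _ => RectilinearApproximation.cardyFormulaZ2_of_rectilinearCardy hRect

end Summit.CriticalPhenomena.CardyFormulaZ2.Theorems
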